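import Literature.AnabelianGeometry.Anabelioids.Basic
import Literature.AnabelianGeometry.Anabelioids.FiberFunctorUnique
import Mathlib.CategoryTheory.Galois.Full
import Mathlib.Topology.Algebra.OpenSubgroup
import HarnessLib

/-!
# Anabelioids: descent of 2-cells along a `π₁`-monomorphism (aloof case)

Tools behind Mochizuki, *Semi-graphs of anabelioids*, Publ. RIMS **42** (2006), §2, Remark 2.4.2
p. 26 and its correction [IUTchI] (*Inter-universal Teichmüller theory I*, Publ. RIMS **57** (2021))
Remark 2.5.3 (iii) p. 54 [cite: Mochizuki2012, IUTchI Rmk 2.5.3 (iii), p.54]: "the isomorphism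
classes of the `φ_v` completely determine the isomorphism class of each of the `φ_e`, as well as each
isomorphism `φ_b`, up to composition with an automorphism … that arises from an automorphism of the
1-morphism of anabelioids `𝒢_e → ℋ_f`", in the language of [GeoAn] §1.1 (2-cells between arrows of
connected anabelioids = natural isomorphisms of exact pull-back functors; basepoints = fibre functors;
`π₁(φ)` = `pi1Map`):

* `isoWhiskerRight_injective_of_faithful`, `exists_iso_of_equivariantIso` — the two-arrow form of
  [GeoAn] Cor. 1.1.6: 2-cells `P ≅ P'` ↔ `Aut F`-equivariant isomorphisms of basepoints
  `P ⋙ F ≅ P' ⋙ F` (SGA1 V §4 through Mathlib's fully faithful `functorToAction`);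
* `isoWhiskerLeft_injective_of_isPi1Mono` — `Q ◁ (-)` is injective on isomorphisms of basepoints
  for a `π₁`-monomorphism `Q`;
* `exists_iso_whiskerLeft_eq_of_aloof` — DESCENT: if `Π_b := π₁(Q)(π₁ E') ≤ π₁(W)` is *aloof*
  (`Π_b ∩ g Π_b g⁻¹` of infinite index in `Π_b` for `g ∉ Π_b`, [SemiAnbd] Def. 2.4 (iv)) and
  `π₁(R)` has open image, every 2-cell `Q ⋙ R ≅ Q ⋙ R'` is `Q ◁ β` for a 2-cell `β : R ≅ R'`.

Proof-only file (no definitions).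
-/

namespace Literature.AnabelianGeometry.Anabelioids

open CategoryTheory CategoryTheory.Limits CategoryTheory.PreGaloisCategory
open scoped Pointwise

universe v₁ u₁

section

variable {Xc : Type u₁} [Category.{v₁} Xc] [GaloisCategory Xc]
  {Yc : Type u₁} [Category.{v₁} Yc] [GaloisCategory Yc]
  {Zc : Type u₁} [Category.{v₁} Zc] [GaloisCategory Zc]

omit [GaloisCategory Xc] [GaloisCategory Yc] in
/-- `α ↦ α ⋆ F` is injective on 2-cells `P ≅ P'` for a faithful `F` (two-arrow form of the
injectivity in [GeoAn] Cor. 1.1.6). [cite: MochizukiGeoAn2004, Cor. 1.1.6 p.14] -/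
theorem isoWhiskerRight_injective_of_faithful (P P' : Yc ⥤ Xc) (F : Xc ⥤ FintypeCat.{v₁})
    [F.Faithful] : Function.Injective fun α : P ≅ P' => Functor.isoWhiskerRight α F := by
  intro α α' h
  apply Iso.ext
  apply NatTrans.ext
  funext B
  have hB := congrArg (fun e : P ⋙ F ≅ P' ⋙ F => e.hom.app B) h
  simp only [Functor.isoWhiskerRight_hom, Functor.whiskerRight_app] at hB
  exact F.map_injective hB

omit [GaloisCategory Yc] in
/-- Two-arrow [GeoAn] Cor. 1.1.6, surjectivity: an `Aut F`-equivariant isomorphism of basepoints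
`P ⋙ F ≅ P' ⋙ F` is `α ⋆ F` for a 2-cell `α : P ≅ P'` (full faithfulness of `functorToAction F`,
SGA1 V §4). [cite: MochizukiGeoAn2004, Cor. 1.1.6 p.14] -/
theorem exists_iso_of_equivariantIso (P P' : Yc ⥤ Xc) (F : Xc ⥤ FintypeCat.{v₁})
    [FiberFunctor F] (τ : P ⋙ F ≅ P' ⋙ F)
    (hτ : ∀ σ : Aut F, Functor.isoWhiskerLeft P σ ≪≫ τ = τ ≪≫ Functor.isoWhiskerLeft P' σ) :
    ∃ α : P ≅ P', Functor.isoWhiskerRight α F = τ := by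
  have hcomm : ∀ (B : Yc) (σ : Aut F),
      σ.hom.app (P.obj B) ≫ τ.hom.app B = τ.hom.app B ≫ σ.hom.app (P'.obj B) := by
    intro B σ
    have h := congrArg (fun e : P ⋙ F ≅ P' ⋙ F => e.hom.app B) (hτ σ)
    simp only [Iso.trans_hom, NatTrans.comp_app, Functor.isoWhiskerLeft_hom,
      Functor.whiskerLeft_app] at h
    exact h
  let hF : (functorToAction F).FullyFaithful := Functor.FullyFaithful.ofFullyFaithful _
  let e : ∀ B : Yc, (functorToAction F).obj (P.obj B) ≅ (functorToAction F).obj (P'.obj B) :=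
    fun B => Action.mkIso (τ.app B) fun σ => by
      ext x
      exact ConcreteCategory.congr_hom (hcomm B σ) x
  let a : ∀ B : Yc, P.obj B ≅ P'.obj B := fun B => hF.preimageIso (e B)
  have ha : ∀ B : Yc, F.map (a B).hom = τ.hom.app B := fun B => by
    have h1 : (functorToAction F).map (a B).hom = (e B).hom := hF.map_preimage _
    exact congrArg Action.Hom.hom h1
  have hnat : ∀ {B B' : Yc} (f : B ⟶ B'), P.map f ≫ (a B').hom = (a B).hom ≫ P'.map f := by
    intro B B' f
    apply F.map_injective
    rw [F.map_comp, F.map_comp, ha, ha]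
    exact τ.hom.naturality f
  refine ⟨NatIso.ofComponents a hnat, ?_⟩
  apply Iso.ext
  apply NatTrans.ext
  funext B
  rw [Functor.isoWhiskerRight_hom, Functor.whiskerRight_app]
  exact ha B

omit [GaloisCategory Yc] [GaloisCategory Zc] in
/-- `π₁(P)` is continuous (Mathlib's topology on `Aut F` is induced from `∏_B Aut (F B)`).
[folklore] -/
private theorem continuous_pi1Map' (P : Zc ⥤ Yc) (Φ : Yc ⥤ FintypeCat.{v₁}) :
    Continuous (pi1Map P Φ) := by
  refine continuous_induced_rng.2 (continuous_pi fun B => ?_)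
  have h1 : Continuous (autEmbedding Φ) := continuous_induced_dom
  have h2 : Continuous (fun t : (∀ A : Yc, Aut (Φ.obj A)) => t (P.obj B)) :=
    continuous_apply (P.obj B)
  exact h2.comp h1

omit [GaloisCategory Zc] in
/-- Whiskering with a `π₁`-monomorphism `Q^*` is injective on isomorphisms of basepoints
(fibre functors) `Φ ≅ Φ'`. [cite: MochizukiGeoAn2004, Def. 1.1.2(ii) p.10] -/
theorem isoWhiskerLeft_injective_of_isPi1Mono (Q : Zc ⥤ Yc) (hQ : IsPi1Mono Q)
    (Φ Φ' : Yc ⥤ FintypeCat.{v₁}) [FiberFunctor Φ] (τ₁ τ₂ : Φ ≅ Φ')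
    (h : Functor.isoWhiskerLeft Q τ₁ = Functor.isoWhiskerLeft Q τ₂) : τ₁ = τ₂ := by
  have h1 : pi1Map Q Φ (τ₁ ≪≫ τ₂.symm) = 1 := by
    apply Iso.ext
    apply NatTrans.ext
    funext W
    have hW := congrArg (fun e : Q ⋙ Φ ≅ Q ⋙ Φ' => e.hom.app W) h
    simp only [Functor.isoWhiskerLeft_hom, Functor.whiskerLeft_app] at hW
    rw [pi1Map_hom_app, Iso.trans_hom, NatTrans.comp_app, Iso.symm_hom, hW, ← NatTrans.comp_app,
      Iso.hom_inv_id]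
    rfl
  have h2 : τ₁ ≪≫ τ₂.symm = Iso.refl _ := hQ Φ (h1.trans (map_one (pi1Map Q Φ)).symm)
  calc τ₁ = (τ₁ ≪≫ τ₂.symm) ≪≫ τ₂ := by simp
    _ = τ₂ := by rw [h2, Iso.refl_trans]

/-- Open subgroups of a compact subgroup have finite index: if `O ≤ L` with `O` open in the compact
subgroup `K`, then `L` has nonzero relative index in `K`. [folklore] -/
private theorem relIndex_ne_zero_of_isOpen {Γ : Type*} [Group Γ] [TopologicalSpace Γ]
    [IsTopologicalGroup Γ] (K O L : Subgroup Γ) (hK : IsCompact (K : Set Γ)) (hOL : O ≤ L)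
    (hO : IsOpen (K.subtype ⁻¹' (O : Set Γ))) : L.relIndex K ≠ 0 := by
  haveI : CompactSpace K := isCompact_iff_compactSpace.mp hK
  have hopen : IsOpen ((O.subgroupOf K : Subgroup K) : Set K) := by
    rw [Subgroup.coe_subgroupOf]
    exact hO
  haveI : Finite (K ⧸ O.subgroupOf K) := Subgroup.quotient_finite_of_isOpen _ hopen
  haveI : (O.subgroupOf K).FiniteIndex := Subgroup.finiteIndex_of_finite_quotient
  haveI : (L.subgroupOf K).FiniteIndex :=
    Subgroup.finiteIndex_of_le (Subgroup.subgroupOf_mono K hOL)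
  exact Subgroup.FiniteIndex.index_ne_zero

/-- The image of an open set under a continuous injective homomorphism from a compact group into a
Hausdorff group is open in the image subgroup (closed embedding). [folklore] -/
private theorem isOpen_subtype_preimage_image {A B : Type*} [Group A] [Group B]
    [TopologicalSpace A] [TopologicalSpace B] [CompactSpace A] [T2Space B] (j : A →* B)
    (hj : Continuous j) (hinj : Function.Injective j) (U : Set A) (hU : IsOpen U) :
    IsOpen (j.range.subtype ⁻¹' (j '' U)) := by
  have hemb : Topology.IsClosedEmbedding j := hj.isClosedEmbedding hinj
  obtain ⟨V, hV, hVU⟩ := hemb.isEmbedding.isInducing.isOpen_iff.mp hU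
  have hset : j.range.subtype ⁻¹' (j '' U) = (fun x : j.range => (x : B)) ⁻¹' V := by
    ext ⟨x, ⟨a, rfl⟩⟩
    simp only [Set.mem_preimage, Subgroup.coe_subtype, Set.mem_image]
    constructor
    · rintro ⟨a', ha', he⟩
      obtain rfl := hinj he
      have : a' ∈ j ⁻¹' V := by rw [hVU]; exact ha'
      exact this
    · intro ha
      exact ⟨a, by rw [← hVU]; exact ha, rfl⟩
  rw [hset]
  exact hV.preimage continuous_subtype_val

omit [GaloisCategory Yc] [GaloisCategory Zc] in
/-- `π₁(P)` is whiskering. [folklore] -/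
private theorem pi1Map_apply_eq (P : Zc ⥤ Yc) (Φ : Yc ⥤ FintypeCat.{v₁}) (x : Aut Φ) :
    pi1Map P Φ x = Functor.isoWhiskerLeft P x := rfl

/-- **Descent along a `π₁`-monomorphism** (the heart of [IUTchI] Rmk 2.5.3 (iii)): for exact
`R, R' : E' ⥤ E`, a `π₁`-monomorphism `Q : W ⥤ E'` (all between connected anabelioids), a basepoint
`F` of `E` with `π₁(R)` of open image, and the ALOOFNESS of `Π_b = π₁(Q)(π₁(E'))` inside
`π₁(W)` at the basepoint `Q ⋙ R ⋙ F` (for `g ∉ Π_b`, `Π_b ∩ g Π_b g⁻¹` has infinite index in `Π_b`),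
every 2-cell `δ : Q ⋙ R ≅ Q ⋙ R'` descends: `δ = Q ◁ β` for a 2-cell `β : R ≅ R'`.  (The element of
`π₁(W)` measuring `δ` against an isomorphism of the basepoints `R ⋙ F ≅ R' ⋙ F` conjugates the open
subgroup `π₁(QR)(π₁ E)` of `Π_b` into `Π_b`, so lies in `Π_b` by aloofness; equivariance then descends
by `π₁`-injectivity of `Q`, and the two-arrow Cor. 1.1.6 produces `β`.)  This is the mechanism
behind [SemiAnbd] Rmk 2.4.2 / [IUTchI] Rmk 2.5.3 (iii) ("determined … up to composition with an
automorphism … that arises from an automorphism of the 1-morphism `𝒢_e → ℋ_f`").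
[cite: Mochizuki2012, IUTchI Rmk 2.5.3 (iii), p.54] -/
theorem exists_iso_whiskerLeft_eq_of_aloof (R R' : Yc ⥤ Xc) (Q : Zc ⥤ Yc)
    (hQ : IsPi1Mono Q) (F : Xc ⥤ FintypeCat.{v₁}) [FiberFunctor F] [FiberFunctor (R ⋙ F)]
    [FiberFunctor (R' ⋙ F)] [FiberFunctor (Q ⋙ (R ⋙ F))]
    (hR : IsOpen (Set.range (pi1Map R F)))
    (haloof : ∀ G : Aut (Q ⋙ (R ⋙ F)), G ∉ (pi1Map Q (R ⋙ F)).range →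
      ((pi1Map Q (R ⋙ F)).range ⊓ ConjAct.toConjAct G • (pi1Map Q (R ⋙ F)).range).relIndex
        (pi1Map Q (R ⋙ F)).range = 0)
    (δ : Q ⋙ R ≅ Q ⋙ R') : ∃ β : R ≅ R', Functor.isoWhiskerLeft Q β = δ := by
  -- `δ ⋆ F`, as an isomorphism of the basepoints `Q ⋙ (R ⋙ F)`, `Q ⋙ (R' ⋙ F)` of `W`
  let δΦ : Q ⋙ (R ⋙ F) ≅ Q ⋙ (R' ⋙ F) := Functor.isoWhiskerRight δ F
  -- equivariance of `δ ⋆ F` (naturality of `σ ∈ Aut F`)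
  have hE : ∀ σ : Aut F, Functor.isoWhiskerLeft Q (Functor.isoWhiskerLeft R σ) ≪≫ δΦ =
      δΦ ≪≫ Functor.isoWhiskerLeft Q (Functor.isoWhiskerLeft R' σ) := by
    intro σ
    apply Iso.ext
    apply NatTrans.ext
    funext W
    exact (σ.hom.naturality (δ.hom.app W)).symm
  have hE' : ∀ (σ : Aut F) {T : Zc ⥤ FintypeCat.{v₁}} (Z : Q ⋙ (R' ⋙ F) ≅ T),
      Functor.isoWhiskerLeft Q (Functor.isoWhiskerLeft R σ) ≪≫ δΦ ≪≫ Z =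
      δΦ ≪≫ Functor.isoWhiskerLeft Q (Functor.isoWhiskerLeft R' σ) ≪≫ Z := by
    intro σ T Z
    rw [← Iso.trans_assoc, hE, Iso.trans_assoc]
  -- an isomorphism of the two basepoints of `E'`, and the discrepancy `G ∈ π₁(W)`
  obtain ⟨τ₀⟩ := nonempty_iso_of_fiberFunctor (R ⋙ F) (R' ⋙ F)
  obtain ⟨G, hG⟩ : ∃ G : Aut (Q ⋙ (R ⋙ F)), G = Functor.isoWhiskerLeft Q τ₀ ≪≫ δΦ.symm :=
    ⟨_, rfl⟩
  -- the open subgroup `π₁(QR)(π₁ E)` of `Π_b`, contained in `Π_b ∩ G Π_b G⁻¹`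
  have hO₁K : ((pi1Map Q (R ⋙ F)).comp (pi1Map R F)).range ≤ (pi1Map Q (R ⋙ F)).range := by
    rintro _ ⟨σ, rfl⟩
    exact ⟨_, rfl⟩
  have hO₁G : ((pi1Map Q (R ⋙ F)).comp (pi1Map R F)).range ≤
      ConjAct.toConjAct G • (pi1Map Q (R ⋙ F)).range := by
    rintro _ ⟨σ, rfl⟩
    rw [Subgroup.mem_pointwise_smul_iff_inv_smul_mem, ← map_inv, ConjAct.toConjAct_smul, inv_inv]
    refine ⟨τ₀ ≪≫ pi1Map R' F σ ≪≫ τ₀.symm, ?_⟩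
    simp only [MonoidHom.comp_apply, pi1Map_apply_eq, Aut.Aut_mul_def, Aut.Aut_inv_def, hG,
      Iso.trans_symm, Iso.symm_symm_eq, Functor.isoWhiskerLeft_trans, Functor.isoWhiskerLeft_symm,
      Iso.trans_assoc, hE' σ, Iso.symm_self_id_assoc]
  have hO₁open : IsOpen ((pi1Map Q (R ⋙ F)).range.subtype ⁻¹'
      (((pi1Map Q (R ⋙ F)).comp (pi1Map R F)).range : Set (Aut (Q ⋙ (R ⋙ F))))) := by
    have hset : (((pi1Map Q (R ⋙ F)).comp (pi1Map R F)).range : Set (Aut (Q ⋙ (R ⋙ F)))) =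
        pi1Map Q (R ⋙ F) '' Set.range (pi1Map R F) := by
      rw [MonoidHom.coe_range, MonoidHom.coe_comp, Set.range_comp]
    rw [hset]
    exact isOpen_subtype_preimage_image _ (continuous_pi1Map' Q (R ⋙ F)) (hQ (R ⋙ F)) _ hR
  have hKc : IsCompact ((pi1Map Q (R ⋙ F)).range : Set (Aut (Q ⋙ (R ⋙ F)))) := by
    rw [MonoidHom.coe_range]
    exact isCompact_range (continuous_pi1Map' Q (R ⋙ F))
  -- aloofness forces `G ∈ Π_b`
  have hGK : G ∈ (pi1Map Q (R ⋙ F)).range := by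
    by_contra hGn
    exact relIndex_ne_zero_of_isOpen _ _ _ hKc (le_inf hO₁K hO₁G) hO₁open (haloof G hGn)
  obtain ⟨g₁, hg₁⟩ := hGK
  rw [pi1Map_apply_eq] at hg₁
  -- the descended isomorphism of basepoints `τ`, with `Q ◁ τ = δ ⋆ F`
  obtain ⟨τ, hτdef⟩ : ∃ τ : R ⋙ F ≅ R' ⋙ F, τ = g₁.symm ≪≫ τ₀ := ⟨_, rfl⟩
  have hτ : Functor.isoWhiskerLeft Q τ = δΦ := by
    rw [hτdef, Functor.isoWhiskerLeft_trans, ← Functor.isoWhiskerLeft_symm, hg₁, hG, Iso.trans_symm,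
      Iso.symm_symm_eq, Iso.trans_assoc, Iso.symm_self_id, Iso.trans_refl]
  -- `τ` is equivariant (checked after `Q ◁`, injective on isomorphisms of basepoints)
  have hτE : ∀ σ : Aut F,
      Functor.isoWhiskerLeft R σ ≪≫ τ = τ ≪≫ Functor.isoWhiskerLeft R' σ := by
    intro σ
    apply isoWhiskerLeft_injective_of_isPi1Mono Q hQ (R ⋙ F) (R' ⋙ F)
    rw [Functor.isoWhiskerLeft_trans, Functor.isoWhiskerLeft_trans, hτ]
    exact hE σ
  -- the 2-cell `β`
  obtain ⟨β, hβ⟩ := exists_iso_of_equivariantIso R R' F τ hτE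
  refine ⟨β, isoWhiskerRight_injective_of_faithful (Q ⋙ R) (Q ⋙ R') F ?_⟩
  apply Iso.ext
  apply NatTrans.ext
  funext W
  exact (congrArg (fun e : R ⋙ F ≅ R' ⋙ F => e.hom.app (Q.obj W)) hβ).trans
    (congrArg (fun e : Q ⋙ (R ⋙ F) ≅ Q ⋙ (R' ⋙ F) => e.hom.app W) hτ)

end

end Literature.AnabelianGeometry.Anabelioids
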